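import Summits.CriticalPhenomena.CardyFormulaZ2.Theorems.CardyIKTransportIKMixedBoxCrossingXorDefs
import Summits.CriticalPhenomena.CardyFormulaZ2.Theorems.CardyIKTransportIKMixedBoxCrossingStubFiniteEnergy

/-!
# Stub `stub_xorFlip` (line `xor-rectangle-flip`, crux `IKMixedBoxCrossing`, stmt-CriticalPhenomena-5911)

Support file (`--supports stmt-CriticalPhenomena-5911`): the XOR RECTANGLE FLIP of the column-mixed IK
gauge (`XorFlip`, S1 of the line). For every column pattern `S` and every cell rectangle
`Q = box a b W H` there is a measurable involution `Φ` of the bit space `Ω` with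
`blackSet S (Φ ω) = blackSet S ω ∆ Q`, `antiSet S (Φ ω) = antiSet S ω` and
`μIK (Φ ⁻¹' E) ≤ 16/9 · μIK E` for every set `E`.

Construction (all four quadrants at once). A plaquette flip at the face `g` (in BOTH plaquette fields, so
the map does not depend on `S`) toggles the colour of `v` iff `g` lies in the anchoring rectangle
`[min 0 v₀, max 0 v₀) × [min 0 v₁, max 0 v₁)` (tree: `faceFlip_sharp`, sharp factor `(1-p)/p = 2/√3`).
For `W, H ≥ 1` the four CORNER faces `{a-1, a+W-1} × {b-1, b+H-1}` of `Q` toggle in total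
`([a ≤ v₀ < a+W] ⊕ κ₀) ∧ ([b ≤ v₁ < b+H] ⊕ κ₁)` with the constants `κ₀ = [a ≤ 0 < a+W]`,
`κ₁ = [b ≤ 0 < b+H]` (`corner_pair_xor`, GF(2)-bilinearity `xor_six_iff`); the three spurious terms
are line/constant toggles, removed by the measure-preserving sign flips `rowFlip_spec` (column signs
along `{x | κ₁[a ≤ x < a+W] ⊕ κ₀κ₁}`) and `colFlip_spec` (row signs along `{y | κ₀[b ≤ y < b+H]}`).
The composite (`crsw_flipSpec_comp`) has factor `((1-p)/p)⁴ · 1 · 1 = 16/9` (`ofReal_factor_pow_four`)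
and equals the closed form `ω ↦ (ω.1 ∆ T_A, ω.2.1 ∆ T_B, ω.2.2.1 ∆ D, ω.2.2.2.1 ∆ D, ω.2.2.2.2)`, an
involution fixing the coins. Degenerate rectangles (`W ≤ 0` or `H ≤ 0`) are empty: `Φ = id`.
The `Negative.*` vocabulary of `XorDefs` and the `PinnedDiagramExchange.*` vocabulary of the flip
machinery are definitionally equal (`mem_blackSet_negative_iff`, `μIK_negative_eq`).
-/

noncomputable section

namespace Summit.CriticalPhenomena.CardyFormulaZ2.Cruxes.IKMixedBoxCrossing.XorRectangleFlip

open scoped ENNReal symmDiff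
open MeasureTheory
open Literature.Probability.Percolation Literature.Probability.LatticeModels
open Summit.CriticalPhenomena.CardyFormulaZ2.Theorems.IKLinearTransport.PinnedDiagramExchange
open Summit.CriticalPhenomena.CardyFormulaZ2.Cruxes.IKMixedBoxCrossing.PairedMirrorExploration.FiniteEnergyStub
open Summit.CriticalPhenomena.CardyFormulaZ2.Theorems.IKMixedBoxCrossing.Negative (pDef)

namespace FlipStub

/-! ## Vocabulary bridge (definitional) -/

/-- The `Negative` and `PinnedDiagramExchange` copies of the colour field agree (same term). [folklore] -/
theorem mem_blackSet_negative_iff (S : Set ℤ) (ω : Ω) (v : Site 2) :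
    v ∈ Summit.CriticalPhenomena.CardyFormulaZ2.Theorems.IKMixedBoxCrossing.Negative.blackSet S ω ↔
      v ∈ blackSet S ω := Iff.rfl

/-- The `Negative` and `PinnedDiagramExchange` copies of the gauge measure agree (same term). [folklore] -/
theorem μIK_negative_eq : Summit.CriticalPhenomena.CardyFormulaZ2.Theorems.IKMixedBoxCrossing.Negative.μIK = μIK := rfl

/-! ## Arithmetic of the corner faces -/

/-- ONE AXIS: the two corner abscissae `a-1`, `a+W-1` of `[a, a+W)` (`W ≥ 1`) meet the anchoring interval
`[min 0 t, max 0 t)` with total parity `[a ≤ t < a+W] ⊕ [a ≤ 0 < a+W]`. [folklore] -/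
theorem corner_pair_xor (a W t : ℤ) (hW : 1 ≤ W) :
    Xor (min 0 t ≤ a - 1 ∧ a - 1 < max 0 t) (min 0 t ≤ a + W - 1 ∧ a + W - 1 < max 0 t) ↔
      Xor (a ≤ t ∧ t < a + W) (a ≤ 0 ∧ 0 < a + W) := by
  rcases le_total 0 t with ht | ht
  · rw [min_eq_left ht, max_eq_right ht, xor_def, xor_def]; omega
  · rw [min_eq_right ht, max_eq_left ht, xor_def, xor_def]; omega

/-- GF(2) BOOKKEEPING: the four corner products plus the two axis corrections give the rectangle. [folklore] -/
theorem xor_six_iff (X₁ X₂ Y₁ Y₂ A₁ A₂ B₁ B₂ κ₀ κ₁ : Prop) (hX : Xor X₁ X₂ ↔ Xor (A₁ ∧ A₂) κ₀)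
    (hY : Xor Y₁ Y₂ ↔ Xor (B₁ ∧ B₂) κ₁) :
    Xor (Xor (Xor (Xor (Xor (κ₀ ∧ B₁ ∧ B₂) (Xor (κ₁ ∧ A₁ ∧ A₂) (κ₀ ∧ κ₁))) (X₂ ∧ Y₂)) (X₁ ∧ Y₂))
        (X₂ ∧ Y₁)) (X₁ ∧ Y₁) ↔ (A₁ ∧ A₂ ∧ B₁ ∧ B₂) := by
  grind

/-- `16/9` as a real cast into `ℝ≥0∞`. [folklore] -/
theorem ofReal_sixteen_ninths : ENNReal.ofReal (16 / 9) = (16 / 9 : ℝ≥0∞) := by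
  rw [ENNReal.ofReal_div_of_pos (by norm_num : (0 : ℝ) < 9), ENNReal.ofReal_ofNat, ENNReal.ofReal_ofNat]

/-! ## The rectangle flip in closed form -/

/-- Transport of a flip specification along a pointwise equality of maps. [folklore] -/
theorem flipSpec_of_eq {Φ Ψ : Ω → Ω} {K : ℝ≥0∞} {P : Site 2 → Prop}
    (hΨ : Measurable Ψ ∧ μIK.map Ψ ≤ K • μIK ∧ (∀ ω, (Ψ ω).2.2.2.2 = ω.2.2.2.2) ∧
      ∀ (S : Set ℤ) (ω : Ω) (v : Site 2), v ∈ blackSet S (Ψ ω) ↔ Xor (v ∈ blackSet S ω) (P v))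
    (hEq : ∀ ω, Ψ ω = Φ ω) :
    Measurable Φ ∧ μIK.map Φ ≤ K • μIK ∧ (∀ ω, (Φ ω).2.2.2.2 = ω.2.2.2.2) ∧
      ∀ (S : Set ℤ) (ω : Ω) (v : Site 2), v ∈ blackSet S (Φ ω) ↔ Xor (v ∈ blackSet S ω) (P v) := by
  obtain rfl : Ψ = Φ := funext hEq
  exact hΨ

/-- The closed-form flip `ω ↦ (ω.1 ∆ T_A, ω.2.1 ∆ T_B, ω.2.2.1 ∆ D, ω.2.2.2.1 ∆ D, ω.2.2.2.2)` is an
involution. [folklore] -/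
theorem closedFlip_involutive (TA TB : Set ℤ) (D : Set (Site 2)) :
    Function.Involutive
      (fun ω : Ω => ((ω.1 ∆ TA, ω.2.1 ∆ TB, ω.2.2.1 ∆ D, ω.2.2.2.1 ∆ D, ω.2.2.2.2) : Ω)) := by
  intro ω
  simp only [symmDiff_symmDiff_cancel_right, Prod.mk.eta]

/-- THE RECTANGLE FLIP (`W, H ≥ 1`): the four sharp corner plaquette flips composed with the two axis
sign corrections, in closed form; factor `16/9`, coins fixed, toggles exactly the cells of
`[a, a+W) × [b, b+H)`, for every column pattern `S`. [folklore] -/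
theorem rectFlip_spec {a b W H : ℤ} (hW : 1 ≤ W) (hH : 1 ≤ H) {TA TB : Set ℤ} {D : Set (Site 2)}
    (hTA : TA = {x | Xor ((b ≤ 0 ∧ 0 < b + H) ∧ a ≤ x ∧ x < a + W) ((a ≤ 0 ∧ 0 < a + W) ∧ (b ≤ 0 ∧ 0 < b + H))})
    (hTB : TB = {y | (a ≤ 0 ∧ 0 < a + W) ∧ b ≤ y ∧ y < b + H})
    (hD : D = {(![a + W - 1, b + H - 1] : Site 2)} ∆ ({(![a - 1, b + H - 1] : Site 2)} ∆
      ({(![a + W - 1, b - 1] : Site 2)} ∆ {(![a - 1, b - 1] : Site 2)})))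
    {Φ : Ω → Ω} (hΦ : Φ = fun ω => ((ω.1 ∆ TA, ω.2.1 ∆ TB, ω.2.2.1 ∆ D, ω.2.2.2.1 ∆ D, ω.2.2.2.2) : Ω)) :
    Measurable Φ ∧ μIK.map Φ ≤ (16 / 9 : ℝ≥0∞) • μIK ∧ (∀ ω, (Φ ω).2.2.2.2 = ω.2.2.2.2) ∧
      ∀ (S : Set ℤ) (ω : Ω) (v : Site 2),
        v ∈ blackSet S (Φ ω) ↔ Xor (v ∈ blackSet S ω) (a ≤ v 0 ∧ v 0 < a + W ∧ b ≤ v 1 ∧ v 1 < b + H) := by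
  subst hΦ hD
  refine flipSpec_of_eq (crsw_flipSpec_congr
    (crsw_flipSpec_comp (faceFlip_sharp ![a - 1, b - 1])
      (crsw_flipSpec_comp (faceFlip_sharp ![a + W - 1, b - 1])
        (crsw_flipSpec_comp (faceFlip_sharp ![a - 1, b + H - 1])
          (crsw_flipSpec_comp (faceFlip_sharp ![a + W - 1, b + H - 1])
            (crsw_flipSpec_comp (rowFlip_spec TA) (colFlip_spec TB)))))) ?_ fun v => ?_) fun ω => ?_
  · -- the factor `((1-p)/p)⁴ · 1 · 1 = 16/9`
    calc _ = ENNReal.ofReal ((1 - (pDef : ℝ)) / pDef) ^ 4 := by ring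
      _ = 16 / 9 := by rw [ofReal_factor_pow_four, ofReal_sixteen_ninths]
  · -- the accumulated toggle predicate is `v ∈ [a, a+W) × [b, b+H)`
    simp only [hTA, hTB, Set.mem_setOf_eq, Matrix.cons_val_zero, Matrix.cons_val_one,
      Matrix.cons_val_fin_one]
    exact xor_six_iff _ _ _ _ _ _ _ _ _ _ (corner_pair_xor a W (v 0) hW) (corner_pair_xor b H (v 1) hH)
  · -- the composite of the six generator flips is the closed form
    simp only [Function.comp_apply, symmDiff_assoc]

end FlipStub

open FlipStub in
/-- **Stub `stub_xorFlip`** (S1, the lever of the line) · XOR RECTANGLE FLIP QUASI-INVARIANCE: for every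
column pattern `S` and every cell rectangle `Q` there is a measurable involution of the gauge bits that
flips the colour of exactly the cells of `Q`, keeps every diagonal, and expands `μIK`-mass of every set by
at most `16/9 = (2/√3)⁴`. [folklore] -/
theorem stub_xorFlip : XorFlip := by
  rintro S Q ⟨a, b, W, H, rfl⟩
  by_cases hWH : 1 ≤ W ∧ 1 ≤ H
  · obtain ⟨hm, hb, -, ht⟩ := rectFlip_spec hWH.1 hWH.2 rfl rfl rfl rfl
    refine ⟨_, hm, closedFlip_involutive _ _ _, fun ω => Set.ext fun v => ?_, fun _ => rfl, fun E => ?_⟩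
    · rw [Set.mem_symmDiff, mem_blackSet_negative_iff, mem_blackSet_negative_iff, ht S ω v]
      rfl
    · rw [μIK_negative_eq]
      exact crsw_preimage_le_of_map_le hm hb E
  · have hQ : box a b W H = ∅ := Set.eq_empty_of_forall_notMem fun v hv => by
      simp only [box, Set.mem_setOf_eq] at hv
      omega
    have h169 : (1 : ℝ≥0∞) ≤ 16 / 9 := by
      rw [← ofReal_sixteen_ninths]
      exact ENNReal.one_le_ofReal.2 (by norm_num)
    refine ⟨id, measurable_id, fun _ => rfl, fun ω => ?_, fun _ => rfl, fun E => ?_⟩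
    · rw [hQ, ← Set.bot_eq_empty, symmDiff_bot]
      rfl
    · rw [Set.preimage_id]
      exact le_mul_of_one_le_left bot_le h169

end Summit.CriticalPhenomena.CardyFormulaZ2.Cruxes.IKMixedBoxCrossing.XorRectangleFlip

end
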